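import Literature.Computability.Complexity.Mod2SosDegreeExplicit
import HarnessLib

/-!
# A Nullstellensatz refutation of `MOD2_N` of degree `(N+1)/2`: Potechin's Theorem 1.2 is tight

Sources: D. Grigoriev, *Linear lower bound on degrees of Positivstellensatz calculus proofs for the
parity*, Theoret. Comput. Sci. 259 (2001) 613–622 [Grigoriev2001TCS] (held
`paper:doi-10-1016-s0304-3975-00-00157-2`): p. 614 "A linear upper bound `O(n)` on the
Nullstellensatz degree is evident", p. 613/622 "a linear (thereby, sharp) lower bound"; A. Potechin,
ITCS 2019 = arXiv:1711.11469 [Potechin2019], p. 4: "we use our machinery to obtain the following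
**tight** SOS lower bound directly. Theorem 1.2. Degree `(n−1)/2` SOS fails to prove that the
equations for the MOD 2 principle are infeasible."  Neither source spells out the matching upper
bound; this file PROVES it in the sharp form, by the elementary telescoping that underlies the
"evident" bound:

for odd `N` and every partial matching `G` of `K_N` with an uncovered vertex `i`, the vertex equation
`s_i = Σ_{e ∋ i} X_e − 1` gives the polynomial identity
`x_G = Σ_{e ∋ i} x_G X_e − x_G · s_i`; an edge `e = {i,u}` with `u` covered by `f ∈ G` contributes the
multiple `x_{G∖f} · (X_f X_e)` of a disjointness axiom, and an edge to an uncovered `u` contributes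
`x_{G ∪ e}`, a partial matching with one more edge.  Descending from the near-perfect matchings
(`|G| = (N−1)/2`, where no uncovered `u ≠ i` is left) to `G = ∅` writes `1` as an element of the ideal
with all products of degree `≤ (N+1)/2` (`Mod2.hasNSRefutationOfDegree`), with integer coefficients.

Consequences (`HasNSRefutationOfDegree.hasSOSRefutation`, `SumOfSquaresRefutation.lean`):
`MOD2_N` has a static SOS refutation of half-degree `d` whenever `N + 1 ≤ 4d`
(`Mod2.hasSOSRefutation_of_le`); together with `Mod2SosDegreeExplicit.lean` this pins the SOS threshold:
unconditionally `N/6 < d_min ≤ ⌈(N+1)/4⌉` (`PseudoMatching.lt_of_hasSOSRefutation_mod2`), and under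
the named fact `Potechin2019_mod2StoryPSD` exactly
`HasSOSRefutation (Mod2.system N) d ↔ N + 1 ≤ 4d` (`Mod2.hasSOSRefutation_iff_of_potechin`) — the
printed "tight".  No named facts, no new notions (one private bookkeeping predicate).

## References

* D. Grigoriev, Theoret. Comput. Sci. 259 (2001) 613–622, p. 614 and Cor. 2 (p. 622). [Grigoriev2001TCS]
* A. Potechin, ITCS 2019, LIPIcs 124:61 = arXiv:1711.11469, Thm 1.2 and the sentence before it (p. 4).
  [Potechin2019]
-/

noncomputable section

open MvPolynomial Finset

namespace Literature.Computability.Complexity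

namespace Mod2

variable {N : ℕ}

/-! ### §1 Bookkeeping: elements of the truncated ideal of `MOD2_N` -/

/-- `p` is a combination `Σ_ι g_ι · (MOD2_N)_ι` with every product of total degree `≤ D`
(membership in the degree-`D` truncated ideal, the shape of `HasNSRefutationOfDegree`).
[cite: Grigoriev2001TCS, p. 613 (Nullstellensatz refutations and their degree)] -/
def InIdeal (N D : ℕ) (p : MvPolynomial (KnEdge N) ℝ) : Prop :=
  ∃ g : Idx N → MvPolynomial (KnEdge N) ℝ,
    (∑ ι, g ι * system N ι) = p ∧ ∀ ι, (g ι * system N ι).totalDegree ≤ D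

/-- A single product `q · s_ι` of degree `≤ D` lies in the truncated ideal.
[cite: Grigoriev2001TCS, p. 613] -/
theorem inIdeal_single {D : ℕ} (ι₀ : Idx N) (q : MvPolynomial (KnEdge N) ℝ)
    (h : (q * system N ι₀).totalDegree ≤ D) : InIdeal N D (q * system N ι₀) := by
  classical
  refine ⟨Pi.single ι₀ q, ?_, fun ι => ?_⟩
  · rw [Finset.sum_eq_single ι₀ (fun ι _ hι => by rw [Pi.single_eq_of_ne hι, zero_mul])
      (fun h => absurd (mem_univ _) h), Pi.single_eq_same]
  · by_cases hι : ι = ι₀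
    · subst hι; rwa [Pi.single_eq_same]
    · rw [Pi.single_eq_of_ne hι, zero_mul, totalDegree_zero]; exact Nat.zero_le _

/-- The truncated ideal is closed under addition. [cite: Grigoriev2001TCS, p. 613] -/
theorem InIdeal.add {D : ℕ} {p q : MvPolynomial (KnEdge N) ℝ} (hp : InIdeal N D p)
    (hq : InIdeal N D q) : InIdeal N D (p + q) := by
  obtain ⟨g₁, hg₁, hd₁⟩ := hp
  obtain ⟨g₂, hg₂, hd₂⟩ := hq
  refine ⟨g₁ + g₂, ?_, fun ι => ?_⟩
  · simp only [Pi.add_apply, add_mul, sum_add_distrib, hg₁, hg₂]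
  · rw [Pi.add_apply, add_mul]
    exact (totalDegree_add _ _).trans (max_le (hd₁ ι) (hd₂ ι))

/-- The truncated ideal is closed under subtraction. [cite: Grigoriev2001TCS, p. 613] -/
theorem InIdeal.sub {D : ℕ} {p q : MvPolynomial (KnEdge N) ℝ} (hp : InIdeal N D p)
    (hq : InIdeal N D q) : InIdeal N D (p - q) := by
  obtain ⟨g₁, hg₁, hd₁⟩ := hp
  obtain ⟨g₂, hg₂, hd₂⟩ := hq
  refine ⟨g₁ - g₂, ?_, fun ι => ?_⟩
  · simp only [Pi.sub_apply, sub_mul, sum_sub_distrib, hg₁, hg₂]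
  · rw [Pi.sub_apply, sub_mul]
    exact (totalDegree_sub _ _).trans (max_le (hd₁ ι) (hd₂ ι))

/-- `0` lies in the truncated ideal. [cite: Grigoriev2001TCS, p. 613] -/
theorem inIdeal_zero {D : ℕ} : InIdeal N D (0 : MvPolynomial (KnEdge N) ℝ) :=
  ⟨0, by simp, fun ι => by rw [Pi.zero_apply, zero_mul, totalDegree_zero]; exact Nat.zero_le _⟩

/-- The truncated ideal is closed under finite sums. [cite: Grigoriev2001TCS, p. 613] -/
theorem InIdeal.sum {D : ℕ} {α : Type*} (s : Finset α) (f : α → MvPolynomial (KnEdge N) ℝ)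
    (h : ∀ a ∈ s, InIdeal N D (f a)) : InIdeal N D (∑ a ∈ s, f a) := by
  classical
  induction s using Finset.induction_on with
  | empty => rw [sum_empty]; exact inIdeal_zero
  | insert a s ha ih =>
    rw [sum_insert ha]
    exact (h a (mem_insert_self _ _)).add (ih fun b hb => h b (mem_insert_of_mem hb))

/-! ### §2 Covered vertices of an edge set -/

/-- The set of vertices covered by the edge set `G ⊆ E(K_N)`. [cite: Potechin2019, Def. 2.6 (p. 5)] -/
def cov (G : Finset (KnEdge N)) : Finset (Fin N) :=
  univ.filter fun v => ∃ e ∈ G, v ∈ (e : Sym2 (Fin N))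

/-- Membership in the covered set. [cite: Potechin2019, Def. 2.6 (p. 5)] -/
theorem mem_cov {G : Finset (KnEdge N)} {v : Fin N} :
    v ∈ cov G ↔ ∃ e ∈ G, v ∈ (e : Sym2 (Fin N)) := by
  simp [cov]

/-- The covered set is the union of the endpoint pairs. [cite: Potechin2019, Def. 2.6 (p. 5)] -/
theorem cov_eq_biUnion (G : Finset (KnEdge N)) :
    cov G = G.biUnion fun e => univ.filter fun v : Fin N => v ∈ (e : Sym2 (Fin N)) := by
  ext v; simp [mem_cov]

/-- A vertex-disjoint edge set with `ℓ` edges covers exactly `2ℓ` vertices.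
[cite: Potechin2019, Def. 2.6 and Example 2.7 (p. 5)] -/
theorem card_cov {G : Finset (KnEdge N)}
    (hG : ∀ e ∈ G, ∀ f ∈ G, e ≠ f → ∀ v : Fin N, v ∈ (e : Sym2 (Fin N)) → v ∉ (f : Sym2 (Fin N))) :
    (cov G).card = 2 * G.card := by
  rw [cov_eq_biUnion, card_biUnion]
  · rw [sum_congr rfl fun e _ => card_filter_mem_edge e, sum_const, smul_eq_mul, mul_comm]
  · intro e he f hf hef
    rw [Function.onFun, Finset.disjoint_left]
    intro v hve hvf
    exact hG e he f hf hef v (mem_filter.1 hve).2 (mem_filter.1 hvf).2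

/-! ### §3 The telescoping: every partial-matching monomial lies in the ideal truncated at `(N+1)/2` -/

/-- The vertex equation `Σ_{e ∋ i} X_e − 1` has total degree at most `1`.
[cite: Grigoriev2001TCS, p. 621 (the vertex equations)] -/
theorem totalDegree_system_vertex_le_one (i : Fin N) :
    (system N (Sum.inr (Sum.inr i))).totalDegree ≤ 1 := by
  rw [system_vertex]
  refine (totalDegree_sub _ _).trans (max_le ?_ (by rw [totalDegree_one]; exact Nat.zero_le _))
  exact (totalDegree_finsetSum _ _).trans (Finset.sup_le fun e _ => (totalDegree_X (R := ℝ) e).le)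

/-- The polynomial identity behind the telescoping: for every vertex `i`,
`x_G = Σ_{e ∋ i} x_G X_e − x_G · (Σ_{e ∋ i} X_e − 1)`. [cite: Grigoriev2001TCS, p. 621 (the vertex equations)] -/
theorem prod_X_eq (G : Finset (KnEdge N)) (i : Fin N) :
    (∏ e ∈ G, (X e : MvPolynomial (KnEdge N) ℝ)) =
      (∑ e ∈ univ.filter (fun e : KnEdge N => i ∈ (e : Sym2 (Fin N))), (∏ f ∈ G, X f) * X e) -
        (∏ f ∈ G, X f) * system N (Sum.inr (Sum.inr i)) := by
  rw [system_vertex, mul_sub, mul_one, mul_sum, sub_sub_cancel]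

/-- The product of the variables of an edge set has total degree at most its size.
[cite: Grigoriev2001TCS, p. 613 (degree of a refutation)] -/
theorem totalDegree_prod_X_le (G : Finset (KnEdge N)) :
    (∏ e ∈ G, (X e : MvPolynomial (KnEdge N) ℝ)).totalDegree ≤ G.card := by
  refine (totalDegree_finsetProd _ _).trans ?_
  rw [card_eq_sum_ones]
  exact sum_le_sum fun e _ => (totalDegree_X (R := ℝ) e).le

/-- A vertex-disjoint edge set of `K_N` has at most `N/2` edges. [cite: Potechin2019, Def. 2.6 (p. 5)] -/
theorem two_mul_card_le {G : Finset (KnEdge N)}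
    (hG : ∀ e ∈ G, ∀ f ∈ G, e ≠ f → ∀ v : Fin N, v ∈ (e : Sym2 (Fin N)) → v ∉ (f : Sym2 (Fin N))) :
    2 * G.card ≤ N := by
  have := card_le_card (subset_univ (cov G))
  rwa [card_univ, Fintype.card_fin, card_cov hG] at this

/-- **The telescoping step.** Let `N = 2m+1` and let `G` be a vertex-disjoint edge set.  If every
vertex-disjoint `G'` with `|G| + 1` edges has `x_{G'}` in the ideal truncated at degree `m + 1`, then
so does `x_G`: pick an uncovered vertex `i` and expand `x_G = Σ_{e ∋ i} x_G X_e − x_G s_i`.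
[cite: Grigoriev2001TCS, p. 614 ("a linear upper bound on the Nullstellensatz degree is evident")]
[cite: Potechin2019, p. 4 (Theorem 1.2 is tight)] -/
theorem prod_X_inIdeal_step {m : ℕ} (G : Finset (KnEdge (2 * m + 1)))
    (hG : ∀ e ∈ G, ∀ f ∈ G, e ≠ f → ∀ v : Fin (2 * m + 1),
      v ∈ (e : Sym2 (Fin (2 * m + 1))) → v ∉ (f : Sym2 (Fin (2 * m + 1))))
    (ih : ∀ G' : Finset (KnEdge (2 * m + 1)),
      (∀ e ∈ G', ∀ f ∈ G', e ≠ f → ∀ v : Fin (2 * m + 1),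
        v ∈ (e : Sym2 (Fin (2 * m + 1))) → v ∉ (f : Sym2 (Fin (2 * m + 1)))) →
      G'.card = G.card + 1 →
      InIdeal (2 * m + 1) (m + 1) (∏ e ∈ G', (X e : MvPolynomial (KnEdge (2 * m + 1)) ℝ))) :
    InIdeal (2 * m + 1) (m + 1) (∏ e ∈ G, (X e : MvPolynomial (KnEdge (2 * m + 1)) ℝ)) := by
  classical
  have hcov : (cov G).card = 2 * G.card := card_cov hG
  have hGm : G.card ≤ m := by have := two_mul_card_le hG; omega
  -- an uncovered vertex `i`
  obtain ⟨i, hi⟩ : ∃ i : Fin (2 * m + 1), i ∉ cov G := by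
    by_contra h
    push Not at h
    have : cov G = univ := eq_univ_iff_forall.2 h
    have hc := congrArg Finset.card this
    rw [card_univ, Fintype.card_fin, hcov] at hc
    omega
  rw [prod_X_eq G i]
  refine InIdeal.sub (InIdeal.sum _ _ fun e he => ?_) (inIdeal_single _ _ ((totalDegree_mul _ _).trans ?_))
  swap
  · have h1 := totalDegree_prod_X_le G
    have h2 := totalDegree_system_vertex_le_one (N := 2 * m + 1) i
    omega
  -- the edge `e = {i, u}`
  have hie : i ∈ (e : Sym2 (Fin (2 * m + 1))) := (mem_filter.1 he).2
  set u : Fin (2 * m + 1) := Sym2.Mem.other hie with hu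
  have heu : s(i, u) = (e : Sym2 (Fin (2 * m + 1))) := Sym2.other_spec hie
  have hue : u ∈ (e : Sym2 (Fin (2 * m + 1))) := Sym2.other_mem hie
  have heG : e ∉ G := fun h => hi (mem_cov.2 ⟨e, h, hie⟩)
  by_cases huc : u ∈ cov G
  · -- `u` covered by `f ∈ G`: a multiple of the disjointness axiom `X_f X_e`
    obtain ⟨f, hfG, huf⟩ := mem_cov.1 huc
    have hfe : f ≠ e := fun h => heG (h ▸ hfG)
    let p : {p : KnEdge (2 * m + 1) × KnEdge (2 * m + 1) //
        p.1 ≠ p.2 ∧ ∃ i : Fin (2 * m + 1), i ∈ (p.1 : Sym2 (Fin (2 * m + 1))) ∧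
          i ∈ (p.2 : Sym2 (Fin (2 * m + 1)))} := ⟨(f, e), hfe, u, huf, hue⟩
    have hprod : (∏ f ∈ G, (X f : MvPolynomial (KnEdge (2 * m + 1)) ℝ)) * X e =
        (∏ f ∈ G.erase f, X f) * system (2 * m + 1) (Sum.inr (Sum.inl p)) := by
      rw [system_pair, ← mul_assoc, prod_erase_mul _ _ hfG]
    rw [hprod]
    refine inIdeal_single _ _ ((totalDegree_mul _ _).trans ?_)
    have h1 := totalDegree_prod_X_le (G.erase f)
    have h2 : (system (2 * m + 1) (Sum.inr (Sum.inl p))).totalDegree ≤ 2 := by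
      rw [system_pair]
      exact (totalDegree_mul _ _).trans (add_le_add (totalDegree_X (R := ℝ) _).le
        (totalDegree_X (R := ℝ) _).le)
    have h3 := card_erase_of_mem hfG
    have h4 : 0 < G.card := card_pos.2 ⟨f, hfG⟩
    omega
  · -- `u` uncovered: `x_G X_e = x_{G ∪ e}`, one more edge
    have hins : (∏ f ∈ G, (X f : MvPolynomial (KnEdge (2 * m + 1)) ℝ)) * X e =
        ∏ f ∈ insert e G, X f := by
      rw [prod_insert heG]; exact mul_comm _ _
    rw [hins]
    refine ih (insert e G) ?_ (by rw [card_insert_of_notMem heG])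
    -- the new edge set is vertex-disjoint
    have key : ∀ f ∈ G, ∀ v : Fin (2 * m + 1), v ∈ (e : Sym2 (Fin (2 * m + 1))) →
        v ∉ (f : Sym2 (Fin (2 * m + 1))) := by
      intro f hf v hv hvf
      rw [← heu, Sym2.mem_iff] at hv
      rcases hv with rfl | rfl
      · exact hi (mem_cov.2 ⟨f, hf, hvf⟩)
      · exact huc (mem_cov.2 ⟨f, hf, hvf⟩)
    intro e' he' f hf hne v hv
    rcases mem_insert.1 he' with rfl | he'G
    · rcases mem_insert.1 hf with rfl | hfG
      · exact absurd rfl hne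
      · exact key f hfG v hv
    · rcases mem_insert.1 hf with rfl | hfG
      · exact fun hvf => key e' he'G v hvf hv
      · exact hG e' he'G f hfG hne v hv

/-- **The telescoping, iterated.** For `N = 2m+1`, every vertex-disjoint edge set `G` of `K_N`
(a partial matching) has `x_G = ∏_{e ∈ G} X_e` in the ideal of `MOD2_N` truncated at degree
`m + 1 = (N+1)/2`.  Downward induction on `|G|` from the near-perfect matchings (`|G| = m`), above
which there are no vertex-disjoint edge sets. [cite: Grigoriev2001TCS, p. 614] [cite: Potechin2019, p. 4] -/
theorem prod_X_inIdeal {m : ℕ} :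
    ∀ (k : ℕ) (G : Finset (KnEdge (2 * m + 1))),
      (∀ e ∈ G, ∀ f ∈ G, e ≠ f → ∀ v : Fin (2 * m + 1),
        v ∈ (e : Sym2 (Fin (2 * m + 1))) → v ∉ (f : Sym2 (Fin (2 * m + 1)))) →
      G.card + k = m →
      InIdeal (2 * m + 1) (m + 1) (∏ e ∈ G, (X e : MvPolynomial (KnEdge (2 * m + 1)) ℝ)) := by
  intro k
  induction k with
  | zero =>
    intro G hG hcard
    refine prod_X_inIdeal_step G hG fun G' hG' hc' => ?_
    exfalso
    have := two_mul_card_le hG'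
    omega
  | succ k ih =>
    intro G hG hcard
    exact prod_X_inIdeal_step G hG fun G' hG' hc' => ih G' hG' (by omega)

/-! ### §4 The theorems -/

/-- **`MOD2_N` has a Nullstellensatz refutation of degree `(N+1)/2`** (`N` odd): `1 = Σ_ι g_ι s_ι`
with all products of total degree `≤ (N+1)/2` and integer coefficients.  This is the sharp form of
Grigoriev's "evident" linear upper bound and the upper-bound half of Potechin's "tight".
[cite: Grigoriev2001TCS, p. 614] [cite: Potechin2019, p. 4 (Theorem 1.2, "tight")] -/
theorem hasNSRefutationOfDegree (hN : Odd N) :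
    HasNSRefutationOfDegree (system N) ((N + 1) / 2) := by
  classical
  obtain ⟨m, rfl⟩ := hN
  have hm : (2 * m + 1 + 1) / 2 = m + 1 := by omega
  rw [hm]
  obtain ⟨g, hg, hdeg⟩ := prod_X_inIdeal (m := m) m ∅ (by simp) (by simp)
  rw [prod_empty] at hg
  exact ⟨univ, g, hg, fun ι _ => hdeg ι⟩

/-- **Potechin's Theorem 1.2 is tight: `MOD2_N` (`N` odd) has a static sum-of-squares refutation of
half-degree `d` as soon as `N + 1 ≤ 4d`** (Potechin-degree `2d ≥ (N+1)/2`), namely the Nullstellensatz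
refutation above read as a Positivstellensatz refutation without squares.
[cite: Potechin2019, p. 4 (Theorem 1.2, "tight")] [cite: Grigoriev2001TCS, p. 614 and Cor. 2 (p. 622, "sharp")] -/
theorem hasSOSRefutation_of_le (hN : Odd N) {d : ℕ} (hd : N + 1 ≤ 4 * d) :
    HasSOSRefutation (system N) d := by
  classical
  refine HasNSRefutationOfDegree.hasSOSRefutation ((hasNSRefutationOfDegree hN).mono ?_)
  obtain ⟨m, rfl⟩ := hN
  omega

/-- **The exact SOS threshold of the MOD 2 principle, given the Potechin fact.** For odd `N ≥ 3`:
`MOD2_N` has a static SOS refutation of half-degree `d` iff `N + 1 ≤ 4d` (lower bound: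
`PseudoMatching.not_hasSOSRefutation_mod2_of_potechin`; upper bound: `hasSOSRefutation_of_le`).
[cite: Potechin2019, Thm 1.2 (p. 4, "tight")] -/
theorem hasSOSRefutation_iff_of_potechin (hP : Mod2Story.Potechin2019_mod2StoryPSD) (hN : Odd N)
    (h3 : 3 ≤ N) (d : ℕ) : HasSOSRefutation (system N) d ↔ N + 1 ≤ 4 * d := by
  refine ⟨fun h => ?_, hasSOSRefutation_of_le hN⟩
  by_contra hc
  have h4 : 4 * d + 1 ≤ N := by obtain ⟨m, rfl⟩ := hN; omega
  exact PseudoMatching.not_hasSOSRefutation_mod2_of_potechin hP hN h3 h4 h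

/-- **The unconditional sandwich.** For odd `N ≥ 3` the least half-degree `d` of a static SOS
refutation of `MOD2_N` satisfies `N < 6 d` and exists with `N + 1 ≤ 4 d`: refutable at
`d = ⌈(N+1)/4⌉`, not refutable for `6d ≤ N`.
[cite: Grigoriev2001TCS, Cor. 2 (p. 622, "linear (thereby, sharp)")] [cite: Potechin2019, Thm 1.2 (p. 4)] -/
theorem sos_threshold_sandwich (hN : Odd N) (h3 : 3 ≤ N) :
    HasSOSRefutation (system N) ((N + 4) / 4) ∧ ∀ d : ℕ, 6 * d ≤ N → ¬ HasSOSRefutation (system N) d :=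
  ⟨hasSOSRefutation_of_le hN (by obtain ⟨m, rfl⟩ := hN; omega),
    fun _ hd => PseudoMatching.not_hasSOSRefutation_mod2 hN h3 hd⟩

/-- **Nullstellensatz degree of `MOD2_N` from below** (via the story pseudo-expectation): for `N ≥ 2`,
a Nullstellensatz refutation of degree `D` is a static SOS refutation of half-degree `⌈D/2⌉`
(`HasNSRefutationOfDegree.hasSOSRefutation`), so `PseudoMatching.lt_of_hasSOSRefutation_mod2` gives
`N < 6⌈D/2⌉ ≤ 3D + 3`.  With `hasNSRefutationOfDegree`: the least Nullstellensatz degree of `MOD2_N`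
(`N` odd) lies in `[(N−2)/3, (N+1)/2]` — "linear (thereby, sharp)".
[cite: Grigoriev2001TCS, p. 614 and Cor. 2 (p. 622)] [cite: Potechin2019, Thm 1.2 (p. 4)] -/
theorem le_of_hasNSRefutationOfDegree {n D : ℕ} (hn : 2 ≤ n)
    (h : HasNSRefutationOfDegree (system n) D) : n ≤ 3 * D + 2 := by
  classical
  have hsos : HasSOSRefutation (system n) ((D + 1) / 2) :=
    HasNSRefutationOfDegree.hasSOSRefutation (h.mono (by omega))
  have := PseudoMatching.lt_of_hasSOSRefutation_mod2 hn hsos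
  omega

/-- **The Nullstellensatz sandwich for `MOD2_N`, `N` odd, `N ≥ 3`:** a refutation of degree `(N+1)/2`
exists, and every refutation has degree `D` with `N ≤ 3D + 2`.
[cite: Grigoriev2001TCS, p. 614 and Cor. 2 (p. 622)] -/
theorem ns_degree_sandwich (hN : Odd N) (h3 : 3 ≤ N) :
    HasNSRefutationOfDegree (system N) ((N + 1) / 2) ∧
      ∀ D : ℕ, HasNSRefutationOfDegree (system N) D → N ≤ 3 * D + 2 :=
  ⟨hasNSRefutationOfDegree hN, fun _ h => le_of_hasNSRefutationOfDegree (by omega) h⟩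

end Mod2

end Literature.Computability.Complexity

end
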